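import Literature.MathematicalPhysics.QuantumFieldTheory.Balaban1983to89.B9Thm31SiteAgmonWeightY
import Literature.MathematicalPhysics.QuantumFieldTheory.Balaban1983to89.B9Thm31SiteGpDecayPar

/-!
# `Balaban1983to89.B9Thm31SiteAgmonWeightPar` — T. Bałaban, *Propagators for lattice gauge theories in a background field*, Commun. Math. Phys. **99** (1985)
# 389–434 [Balaban1985BackgroundPropagators] Thm 3.1 (3.46) p. 398, by S. Agmon's positive-weight method [Agmon1982]: ★★ **(3.46a) FOR `G′(U; par)` AT A GENERIC SITE
# TRANSPORTER WITH THE AGMON WEIGHT `e^{δρ}`** — dag-n06-w1's `B9Thm31SiteAgmonWeightY` §3 re-pressed over `par` from the three transporter laws (link 2 of the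
# CASCADE-K re-press of the (3.46)₄ chain; link 1 = `B9Thm31SiteGpDecayPar`)

statement-level skeleton of published theorems with citation tags; proofs where landed; nothing here is a claim about the Yang–Mills mass gap

WHY THIS FILE.  w1's file 7 instantiates file 6's weight hypotheses at `ω = e^{δρ}` (§1–§2, transporter-free, reused here BY NAME: `bondRatio_exp_le ∕ bondRatio_exp_le' ∕
blockOsc_exp_le`) and concludes (§3) at `G′ = GpY i (parSymY i)` on the class (3.35) with the budget `δ²(2(d+1) + D²) ≤ 1∕16` and the canonical rate `δ₀ = 1∕(4(d+2))`
(tied to the coercivity constant `1∕8`).  THIS FILE is §3 at a GENERIC `par` from link 1's `hs_restrict_GpY_le_par`: the budget reads `δ²(2(d+1) + D²) ≤ κ∕2` and the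
prefactor `((κ∕2)²)⁻¹`; the rate `δ` stays a PARAMETER (no canonical choice is made before the knit instance, whose `κ = 1∕32` admits `δ = 1∕(8(d+2))`).
★★★ `hs_restrict_GpY_le_exp_par` — `G ≤ U(N)`, `N ≥ 1`, `U` and the legs `G`-valued, inverse-symmetry, level-weighted coercivity `κ > 0`; `0 ≤ δ ≤ 1`, `δD ≤ 1`,
`δ²(2(d+1) + D²) ≤ κ∕2`; `ρ` with bond increments `≤ (L^{lev})⁻¹` (both ends) and block oscillation `≤ D`; `ρ = 0` on `B`, `ρ ≥ r` on `A`, levels `≤ j_A ∕ j_B`; `λ`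
vanishing off `B`.  THEN `Σ_{z∈A} HS((G′(U; par)λ)(z)) ≤ ((κ∕2)²)⁻¹·((L^{j_A})²(L^{j_B})²∕(e^{δr})²)·‖λ‖²₁`; ★★ `hs_restrict_GpY_le_exp_blockOsc_par` — the same with the
block oscillation `D = d + 1` (the shape every consumer uses).
HONEST SCOPE.  One finite lattice operator at a time, laws displayed, constants explicit; NOT a node discharge; count-neutral; nothing continuum ∕ OS ∕ mass gap ∕ Clay.
Cell `pub-ymgap` (D-0062), Track A node N06 [B9], seat `pub-ymgap-dag-n06-l` (g37), 2026-08-30; NEW file; nothing landed is modified.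
-/

noncomputable section

namespace Literature.MathematicalPhysics.QuantumFieldTheory.Balaban1983to89.B9Thm31SiteAgmonWeightPar

open Literature.MathematicalPhysics.QuantumFieldTheory.Balaban1983to89
open Node00 B6KLevelCensusIndexV1 B6Geom246MultiLevelBox B6MultiLevelBoxOperator B6MultiLevelTorusOperator B6GlobalChartV1 B9BackgroundsKLevelV1
  B9Eq39Adjoint B9Thm311ReadingCoords B9Thm311DeltaPrimePos B9Thm31SiteGpDecayReg335Y B9Thm31SiteAgmonWeightY B9Thm31SiteGpDecayPar
open scoped Matrix Matrix.Norms.L2Operator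

variable {d ℓ : ℕ} {hd : 1 ≤ d + 1} {hL : Odd (ℓ + 1) ∧ 1 < ℓ + 1} {b₀ b₁ : ℝ}
variable (i : KIdx d ℓ hd hL b₀ b₁) {N : ℕ} {G : Subgroup (Matrix (Fin N) (Fin N) ℂ)ˣ} (par : SiteParY (Matrix (Fin N) (Fin N) ℂ) i)

/-- ★★★ **(3.46a) FOR `G′(U; par)` WITH THE AGMON WEIGHT `e^{δρ}`, FROM THE THREE TRANSPORTER LAWS** (w1's `hs_restrict_GpY_parSymY_le_exp` at a generic `par`; budget
`δ²(2(d+1) + D²) ≤ κ∕2`, prefactor `((κ∕2)²)⁻¹`). [cite: Balaban1985BackgroundPropagators, Thm 3.1 (3.46) p.398; Agmon1982, Ch.1, Thm 1.5; CombesThomas1973] -/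
theorem hs_restrict_GpY_le_exp_par [Nonempty (Fin N)] (hG : G ≤ B7Prop2Explicit.unitaryUnits (Matrix (Fin N) (Fin N) ℂ))
    {U : CfgY (Matrix (Fin N) (Fin N) ℂ) i} (hU : ∀ μ x, U μ x ∈ G) (hpar : ∀ z w : SiteY i, par U z w ∈ G)
    (hinv : ∀ z z' : SiteY i, par U z z' = (par U z' z)⁻¹) {κ : ℝ} (hκ0 : 0 < κ)
    (hcoer : ∀ Φ : SiteY i → Matrix (Fin N) (Fin N) ℂ,
      κ * ∑ z : SiteY i, (((((ℓ + 1) ^ (blkOf i.D.toDomains z).1.1 : ℕ) : ℝ)) ^ 2)⁻¹ * ∑ a, ∑ b, ‖Φ z a b‖ ^ 2 ≤ trIP (fun _ => (1 : ℝ)) Φ (deltaPrimeAY i par U Φ))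
    {δ D : ℝ} (hδ0 : 0 ≤ δ) (hδ1 : δ ≤ 1) (hδD : δ * D ≤ 1)
    (hδκ : δ ^ 2 * (2 * ((d : ℝ) + 1) + D ^ 2) ≤ κ / 2) {ρ : SiteY i → ℝ}
    (hρ1 : ∀ μ z, |ρ (shiftY i μ z) - ρ z| ≤ ((((ℓ + 1) ^ (blkOf i.D.toDomains z).1.1 : ℕ) : ℝ))⁻¹)
    (hρ2 : ∀ μ z, |ρ (shiftY i μ z) - ρ z| ≤ ((((ℓ + 1) ^ (blkOf i.D.toDomains (shiftY i μ z)).1.1 : ℕ) : ℝ))⁻¹)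
    (hρD : ∀ z w : SiteY i, blkOf i.D.toDomains w = blkOf i.D.toDomains z → |ρ z - ρ w| ≤ D)
    {A B : Finset (SiteY i)} {Ψ : SiteY i → Matrix (Fin N) (Fin N) ℂ} (hΨ : ∀ z, z ∉ B → Ψ z = 0) (hρB : ∀ z ∈ B, ρ z = 0)
    {jA jB : ℕ} (hjA : ∀ z ∈ A, (blkOf i.D.toDomains z).1.1 ≤ jA) (hjB : ∀ z ∈ B, (blkOf i.D.toDomains z).1.1 ≤ jB)
    {r : ℝ} (hr : ∀ z ∈ A, r ≤ ρ z) :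
    ∑ z ∈ A, ∑ a, ∑ b, ‖GpY i par U Ψ z a b‖ ^ 2
      ≤ ((κ / 2) ^ 2)⁻¹ * (((((ℓ + 1) ^ jA : ℕ) : ℝ)) ^ 2 * ((((ℓ + 1) ^ jB : ℕ) : ℝ)) ^ 2 / Real.exp (δ * r) ^ 2) * trIP (fun _ => (1 : ℝ)) Ψ Ψ := by
  have hω : ∀ z, 0 < Real.exp (δ * ρ z) := fun z => Real.exp_pos _
  have hκ : ((d : ℝ) + 1) * (2 * δ ^ 2) + (2 * δ ^ 2 * D ^ 2) / 2 ≤ κ / 2 := by nlinarith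
  have hωB : ∀ z ∈ B, Real.exp (δ * ρ z) = 1 := fun z hz => by rw [hρB z hz, mul_zero, Real.exp_zero]
  have hW : ∀ z ∈ A, Real.exp (δ * r) ≤ Real.exp (δ * ρ z) := fun z hz => Real.exp_le_exp.2 (mul_le_mul_of_nonneg_left (hr z hz) hδ0)
  exact hs_restrict_GpY_le_par i par hG hU hpar hinv hκ0 hcoer hω (fun μ z => bondRatio_exp_le i hδ0 hδ1 μ z (hρ1 μ z))
    (fun μ z => bondRatio_exp_le' i hδ0 hδ1 μ z (hρ2 μ z)) (fun z w hzw => blockOsc_exp_le i hδ0 hδD z w (hρD z w hzw)) hκ hΨ hωB hjA hjB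
    (Real.exp_pos _) hW

/-- ★★ **THE BLOCK-OSCILLATION SHAPE `D = d + 1`** (the one every consumer reads: print's weighted distance has oscillation `≤ d+1` on a block): the rate is any `δ` with
`0 ≤ δ ≤ 1`, `δ(d+1) ≤ 1`, `δ²(2(d+1) + (d+1)²) ≤ κ∕2`. [cite: Balaban1985BackgroundPropagators, Thm 3.1 (3.46) p.398, p.397 (weighted distance); Agmon1982, Ch.1, Thm 1.5] -/
theorem hs_restrict_GpY_le_exp_blockOsc_par [Nonempty (Fin N)] (hG : G ≤ B7Prop2Explicit.unitaryUnits (Matrix (Fin N) (Fin N) ℂ))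
    {U : CfgY (Matrix (Fin N) (Fin N) ℂ) i} (hU : ∀ μ x, U μ x ∈ G) (hpar : ∀ z w : SiteY i, par U z w ∈ G)
    (hinv : ∀ z z' : SiteY i, par U z z' = (par U z' z)⁻¹) {κ : ℝ} (hκ0 : 0 < κ)
    (hcoer : ∀ Φ : SiteY i → Matrix (Fin N) (Fin N) ℂ,
      κ * ∑ z : SiteY i, (((((ℓ + 1) ^ (blkOf i.D.toDomains z).1.1 : ℕ) : ℝ)) ^ 2)⁻¹ * ∑ a, ∑ b, ‖Φ z a b‖ ^ 2 ≤ trIP (fun _ => (1 : ℝ)) Φ (deltaPrimeAY i par U Φ))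
    {δ : ℝ} (hδ0 : 0 ≤ δ) (hδ1 : δ ≤ 1) (hδD : δ * ((d : ℝ) + 1) ≤ 1)
    (hδκ : δ ^ 2 * (2 * ((d : ℝ) + 1) + ((d : ℝ) + 1) ^ 2) ≤ κ / 2) {ρ : SiteY i → ℝ}
    (hρ1 : ∀ μ z, |ρ (shiftY i μ z) - ρ z| ≤ ((((ℓ + 1) ^ (blkOf i.D.toDomains z).1.1 : ℕ) : ℝ))⁻¹)
    (hρ2 : ∀ μ z, |ρ (shiftY i μ z) - ρ z| ≤ ((((ℓ + 1) ^ (blkOf i.D.toDomains (shiftY i μ z)).1.1 : ℕ) : ℝ))⁻¹)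
    (hρD : ∀ z w : SiteY i, blkOf i.D.toDomains w = blkOf i.D.toDomains z → |ρ z - ρ w| ≤ (d : ℝ) + 1)
    {A B : Finset (SiteY i)} {Ψ : SiteY i → Matrix (Fin N) (Fin N) ℂ} (hΨ : ∀ z, z ∉ B → Ψ z = 0) (hρB : ∀ z ∈ B, ρ z = 0)
    {jA jB : ℕ} (hjA : ∀ z ∈ A, (blkOf i.D.toDomains z).1.1 ≤ jA) (hjB : ∀ z ∈ B, (blkOf i.D.toDomains z).1.1 ≤ jB)
    {r : ℝ} (hr : ∀ z ∈ A, r ≤ ρ z) :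
    ∑ z ∈ A, ∑ a, ∑ b, ‖GpY i par U Ψ z a b‖ ^ 2
      ≤ ((κ / 2) ^ 2)⁻¹ * (((((ℓ + 1) ^ jA : ℕ) : ℝ)) ^ 2 * ((((ℓ + 1) ^ jB : ℕ) : ℝ)) ^ 2 / Real.exp (δ * r) ^ 2) * trIP (fun _ => (1 : ℝ)) Ψ Ψ :=
  hs_restrict_GpY_le_exp_par i par hG hU hpar hinv hκ0 hcoer hδ0 hδ1 hδD hδκ hρ1 hρ2 hρD hΨ hρB hjA hjB hr

end Literature.MathematicalPhysics.QuantumFieldTheory.Balaban1983to89.B9Thm31SiteAgmonWeightPar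

end
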